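import Mathlib.LinearAlgebra.Finsupp.LinearCombination
import Mathlib.LinearAlgebra.Matrix.Notation
import Mathlib.LinearAlgebra.Matrix.ToLin
import Mathlib.LinearAlgebra.Projection
import Mathlib.LinearAlgebra.Dimension.Free
import Mathlib.LinearAlgebra.FiniteDimensional.Basic
import Mathlib.Algebra.Module.Projective
import Mathlib.Data.Matrix.Mul
import Mathlib.Algebra.Field.Basic
import Mathlib.Algebra.Ring.Parity
import Mathlib.Algebra.CharP.Defs
import Mathlib.Data.Nat.Prime.Defs
import Mathlib.Data.Fintype.Pi
import Mathlib.Order.Interval.Finset.Nat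
import Mathlib.Tactic.FieldSimp
import Mathlib.Tactic.FinCases
import Mathlib.Tactic.Module
import Mathlib.Logic.Equiv.Fin.Basic
import HarnessLib

/-!
# The Décoppet–Haïoun height-two mixed Verlinde invariant of 4-dimensional 2-handlebodies

Topic `Literature/QuantumTopology/MixedVerlinde` (definition request `defn-mixedVerlindeRLinkInvariant`,
route `VerlindeRLinks` of `SmoothPoincare4`, items `VrlSkeinCertificate` / `VrlSkeinBlindOnSphere`).

Décoppet–Haïoun (arXiv:2512.14849, Dec. 2025) attach to every prime `p > 3` and a primitive fourth
root of unity `ζ = A² ∈ k` (`char k = p`, `A = ζ^{1/2}` a primitive eighth root of unity,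
`A⁴ = -1`) the invariant `Ṡ = Ṡ^{ζ^{1/2}}_{p^{(2)}}(W) ∈ k` of a 4-dimensional 2-handlebody `W`
up to 2-equivalence (their Corollary p. 4 and Def. 1.11, built on the skein functor
`S_B : HD₄^{2,3,4} → Vec` of Costantino–Geer–Haïoun–Patureau-Mirand (2023/2026), Thm. 1.9 (1),
for `B = Ver^{ζ^{1/2}}_{p^{(2)}}`, the height-two mixed Verlinde category of
Sutton–Tubbenhauer–Wedrich–Zhu (2023)).  It is computed (DH §1.3, Figure 1) from a Kirby diagram of
`W` in dotted-circle notation: start from the blue skein `Γ₀` = a `T_ζ(1)`-coloured circle in a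
small ball (DH Example 3.3), colour every 2-handle attaching curve RED and turn it BLUE with the
chromatic morphism `c` (DH eq. (5), Prop. 3.4) — the curve becomes a `G = ⊕_{v=2}^{2p-1} T_ζ(v-1)`
coloured parallel cable carrying a box `c_{v-1}` where it runs next to a `T_ζ(1)` strand of `Γ₀`
—, insert the cutting morphism `Λ` (DH Def. 1.5, Lemma 3.2) on the bundle of strands through the
spanning disc of each dotted circle (DH eq. (3)), and evaluate the resulting skein in `S³` with the
modified trace `t`, `t(E₁) = 1` (DH §3.1).  Theorem B: `Ṡ(CP²) = Ṡ(CP²bar) = Ṡ(S² × S²) = 0` for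
`p > 3`; Theorem A: no extension to 1-handles.

This file makes that recipe a **closed formula**: a function
`mixedVerlindeHandlebodyInvariant p A m w : k` of a combinatorial presentation `w : PlatWord` of
the Kirby diagram (below), defined from explicit finite matrices over `k`, with no category theory.
Everything is realised in the classical **tensor-space (R-matrix) state model** of the
Temperley–Lieb category (Kauffman 1987; Kauffman–Lins 1994, §2): a strand is `V = k²`, `n`
parallel strands are `V^{⊗ n}` with basis `Idx n = Fin n → Fin 2`, cups/caps/crossings are the
matrices `cupCoeff`, `capCoeff`, `rMatrix` (§1), and a planar diagram read bottom-to-top is a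
composite of local operators on the ambient space `TSpace k = ⊕ₙ V^{⊗ n}` (basis: words in
`Fin 2`).  The assignment diagram ↦ operator is a faithful monoidal functor on `TL^{ζ^{1/2}}`
(faithfulness of the tensor-space representation of `TL_n(-[2]_ζ)`, Goodman–Wenzl 1993 §2;
STWZ 2023 §4.B), so all of DH's Temperley–Lieb identities hold verbatim for these matrices; the
converse (fullness, quantum Schur–Weyl duality) is never used.

## Contents

1. **State model** — `cupCoeff`, `capCoeff` (`cap ∘ cup = -A² - A⁻² =: loopValue A`, `= 0` if
   `A⁴ = -1`: `loopValue_eq_zero_of_pow_four`; zig-zag `capCoeff_mul_cupCoeff`), `uTwo = cup ∘ cap`,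
   `rMatrix` (DH's displayed crossing `╱-over = ζ^{1/2}·|| + ζ^{-1/2}·≍`; Reidemeister II
   `rMatrix_true_mul_false`), `localOp`/`cupAt`/`capAt`/`boxAt`/`crossAt` on `TSpace k`.  With these
   conventions a positive curl is `-A³ = A⁻¹ = ζ^{-1/2} = θ₁` (DH, proof of Prop. 2.7), which fixes
   the dictionary with DH's pictures.
2. **Eve projectors and DH's boxes** — `jwProj A n`: the projection of `V^{⊗(n+2)}` onto
   `capKer = ⋂ ker capᵢ` along `cupRange = Σ im cupᵢ` (junk `id` if not complementary).  If the
   Jones–Wenzl-type idempotent `f ∈ TL_{n+2}` (nonzero, killed by all cups above and caps below)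
   exists then `f = 𝟙 + (diagrams with a cup on top and a cap below)`, so `ker f = cupRange`,
   `f|capKer = id`, `capKer ∩ cupRange = 0`, and `f` IS this projection; at `δ = 0` in
   characteristic `p` it exists exactly at the Eves of STWZ (2023) §3 — below `2p - 1` strands: the
   odd strand numbers — and is then DH's `E_{v-1}`, `v = [a₁, 0]_{p,2}` (DH §2.1, eq. (7)–(8)).
   `dhE A n` = DH's `E_n` (`E_{2a} = E_{2a-1} ⊗ 𝟙`, DH Prop. 2.3 (1), Example 2.1), `zBox` = DH's
   `Z⁰_v` (Notation 2.4), `eveCoeff v = (-1)^{a₁-1} a₁` (DH Prop. 3.1), `chromBox A v` = DH's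
   `c_{v-1}` (Prop. 3.4).
3. **Modified trace and cutting operators** — `mTrace A n F`: for `F ∈ End(V^{⊗(n+1)})` in the
   Temperley–Lieb image, the right partial trace over the last `n` strands is the scalar
   `(∑_s F_{(0s),(0s)} ∏ⱼ μ(sⱼ))·𝟙` on `T(1)` (`μ(0) = -A²`, `μ(1) = -A⁻²`), and `t(F)` is that scalar
   because `t(E₁) = 1` (DH §3.1, eq. (1)); `mPair` the induced pairing
   `Hom(𝟙, T(1)^{⊗N}) × Hom(T(1)^{⊗N}, 𝟙) → k` on `cupSpan × capSpan` (images of `TL(0,N)`,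
   `TL(N,0)`); `cuttingMatrix A N` = a lift to `TL_N` of the cutting morphism `Λ_{T(1)^{⊗N}}`
   (DH Def. 1.5: `∑ xᵢ ∘ xⁱ` over dual bases modulo the radical of the pairing = the ideal
   `J_{p^{(2)}}`), via a generalized inverse of the Gram matrix (`exists_generalizedInverse`);
   `cuttingMatrix A 0 = 0`.  By additivity and naturality of the Casimir element,
   `Λ_{T(1)^{⊗N}}` restricts to `Λ_P` on every summand `P` cut out by the idempotents carried by the
   cables, so one operator per total strand number suffices.
4. **Plat words and the invariant** — `Strand`, `Slice`, `PlatWord`, `evalSlice`, `colourValue`,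
   `mixedVerlindeHandlebodyInvariant`, the route's alias `mixedVerlindeRLinkInvariant`, the test
   words `unknotWord`, `hopfWord`, `cancellingPairWord`, and the named fact
   `decoppetHaioun_theoremB`.

## Input format (the combinatorial Kirby diagram) and the formula

A `PlatWord` is a list of `Slice`s read from BOTTOM to TOP, acting on a row of labelled strands
(positions `0, 1, …` from the left).  Labels (`Strand`): `gamma` = a strand of the blue skein `Γ₀`
(colour `T_ζ(1)`, one Temperley–Lieb strand) and `handle j` = a strand of the attaching circle of
the 2-handle number `j < m` (after red-to-blue: a parallel cable of `v_j - 1` strands for the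
summand `T_ζ(v_j - 1)` of `G`, `2 ≤ v_j ≤ 2p - 1`).  The row starts and ends as the single `gamma`
strand: the word is the (1,1)-tangle obtained by cutting the circle `Γ₀` open, and closing it up
gives the whole picture `Γ₀ ∪ (attaching link)`; `Γ₀` must be an unknot bounding a disc disjoint
from everything else (it may be stretched by finger moves to reach the handles; each `handle j`
label must be used for ONE closed component).  Slices:

* `cup i c` — a local minimum: two new strands labelled `c` appear at positions `i, i+1`;
* `cap i` — a local maximum joining the strands at `i, i+1` (equal labels);
* `cross i over` — the strands at `i, i+1` cross; `over = true` iff the strand going from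
  bottom-left to top-right is above (DH's displayed crossing; bracket `A·|| + A⁻¹·≍`);
* `plate i n` — the spanning disc of a DOTTED CIRCLE (a 1-handle of `W`, i.e. a 3-handle of the
  cobordism `-W : ∂W → ∅`), drawn as a horizontal plate pierced transversally by exactly the `n ≥ 1`
  consecutive strands `i, …, i+n-1` (isotope the diagram so that every dotted circle is a small
  round circle about a bundle of vertical strands, DH eq. (3), Figure 1); the dotted circle itself
  is not drawn;
* `chrom i` — the chromatic box of handle `j`: requires label `handle j` at position `i` and
  `gamma` at `i + 1` (the red curve immediately to the LEFT of a `Γ₀` strand, DH eq. (5)); exactly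
  one per 2-handle.

Framings are blackboard framings of the word (add curls `cup`–`cross`–`cap` to adjust; one curl
with `over = true` on the right of an upward strand is DH's twist `θ`, framing change `+1` in their
convention `CP² ↔ θ`).  **Formula** (DH §1.3 made explicit): for a colouring
`v : handles → [2, 2p-1]` replace each `handle j` strand by `v_j - 1` parallel strands, each `gamma`
strand by one strand, each cup/cap/crossing by its cabled version, each `chrom` by the box
`chromBox A v_j = c_{v_j - 1}` on the `v_j` strands (cable + `Γ₀` strand), each `plate` by
`cuttingMatrix A N = Λ_{T(1)^{⊗N}}` on the `N` cabled strands through it; the composite operator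
maps the vacuum word `[0]` (the open `T(1)` strand in state `e₀`) to `λ_v • [0]`, and
`Ṡ(W) = ∑_v λ_v` (`colourValue`, `mixedVerlindeHandlebodyInvariant`).  Here we used: red-to-blue
may be performed at any point of each red curve against any adjacent projective blue strand
(CGHP 2023, Lemma 2.3 / DH §1.2), the `G`-coloured curve with its block-diagonal boxes is the sum
over `v` of the `T(v-1)`-cabled curves, the idempotent `E_{v-1}` contained in `c_{v-1}` projects the
cable (once suffices, by naturality of the braiding), and cutting `Γ₀` open at a `T(1)` strand
computes `t` directly (`End(T(1)) = k`, `t(E₁) = 1`, DH eq. (2)), so no partial trace is taken.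
Ill-formed words evaluate to `0` (junk, `evalSlice`); a plate pierced by no strand is not allowed
(`n ≥ 1`; push a `Γ₀` finger through it — the value is then `0`, a split `T(1)` circle carrying
the loop value `0`).

## The route's `σ_p` (R-links)

For an `n`-component R-link `L ⊂ S³` the closed manifold `Σ_L = 0h ∪ (2-handles along L) ∪ n(3h) ∪ 4h`
minus its 0-handle is a morphism `S³ → ∅` of `HD₄^{2,3,4}`; read upside down it is `-W` for the
2-handlebody `W = 0h ∪ n(1h) ∪ n(2h)` (duals of the 4-, 3-, 2-handles) with `∂W = S³` (DH §1.3 and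
footnote 2: "the two notions correspond to each other under orientation reversal").  Hence
`σ_p(L, spheres) := S(Σ_L ∖ 0h)(Γ₀) = Ṡ(W)` is `mixedVerlindeRLinkInvariant p A n w` for a plat
word `w` of the dual dotted-circle diagram of `W` (n dotted circles, n framed curves); producing
`w` from `(L, sphere system)` is Kirby calculus (turning the handlebody upside down,
Gompf–Stipsicz §5.5) and is the certificate-writer's task.  `Ṡ(D⁴) = 1`
(`mixedVerlindeHandlebodyInvariant_nil`), so a value `≠ 1` certifies that `W` is not 2-equivalent
to `D⁴` by the invariance theorem below.

## What is cited, not proved here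

* 2-equivalence invariance / functoriality: `S_B : HD₄^{2,3,4} → Vec` is a symmetric monoidal
  functor for unimodular finite ribbon `B` with a modified trace (CGHP 2023/2026, Thm. 1.9 (1) of DH;
  DH Corollary p. 4), hence `Ṡ` is invariant under isotopy of the diagram, handle slides of
  2-handles over 2-handles and over 1-handles, 1-handle slides, and births/deaths of cancelling
  1/2 pairs; and independence of the value from the position of the chromatic boxes, of `Γ₀`'s
  fingers and of the chosen lift of `Λ` (CGHP Lemma 2.3, Props. 5.2–5.3).  A combinatorial move
  set on `PlatWord` with this invariance is NOT vendored here (route item `VrlSkeinFunctorial`).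
* Existence of the Eve projectors for odd strand numbers `≤ 2p - 3` (STWZ 2023 §3, Thm. 3.19;
  Goodman–Wenzl 1993 Thm. 2.5); DH Props. 2.3, 2.6, 2.7, 3.1, Lemma 3.2, Prop. 3.4 (the algebra
  behind `chromBox`), and Theorem B (`decoppetHaioun_theoremB`, a named fact about the words
  `unknotWord (±1)`, `hopfWord`).
* Evidence (ledger item `defn-mixedVerlindeRLinkInvariant`): a Python transcription of exactly these
  definitions over `𝔽₂₅`, `𝔽₄₉` reproduces DH Example 2.1 (`E₃ = 𝟙 - U₁U₂ - U₂U₁`), the relations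
  of Prop. 2.3 / Notation 2.4 / Lemma 2.5, Prop. 2.7 (twists), Prop. 3.1 (traces) for all `v ≤ 9`,
  the chromatic identity DH eq. (4) for `V = T(1), T(2), T(3)` with the `Λ`, `c` defined here, and
  gives `Ṡ(D⁴) = 1`, `Ṡ(unknot, framings 0, ±1) = 0` (Thm. B), `Ṡ(dotted circle + meridian) = 1`
  (cancellation), `Ṡ(S¹ × D³) = 0` at `p = 5`.

## References

* T. D. Décoppet, B. Haïoun, *Invariants of 4-Dimensional 2-Handlebodies from the Temperley–Lieb
  Category in Positive Characteristic*, arXiv:2512.14849 (2025). [DecoppetHaioun2025]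
* F. Costantino, N. Geer, B. Haïoun, B. Patureau-Mirand, *Skein (3+1)-TQFTs from non-semisimple
  ribbon categories*, SIGMA 22 (2026) 034, arXiv:2306.03225. [CostantinoEtAl2026]
* L. Sutton, D. Tubbenhauer, P. Wedrich, J. Zhu, *SL2 tilting modules in the mixed case*, Selecta
  Math. 29 (2023) 39. [SuttonEtAl2023]
* F. M. Goodman, H. Wenzl, *The Temperley–Lieb algebra at roots of unity*, Pacific J. Math. 161
  (1993) 307–334. [GoodmanWenzl1993]
* L. H. Kauffman, *State models and the Jones polynomial*, Topology 26 (1987). [Kauffman1987]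
* L. H. Kauffman, S. Lins, *Temperley–Lieb recoupling theory and invariants of 3-manifolds*,
  Ann. of Math. Stud. 134 (1994), §2. [KauffmanLins1994]
* Mathlib: no Temperley–Lieb / Kauffman bracket / skein theory (searched `Temperley`, `Kauffman`,
  `skein`, `Jones`); used: `Finsupp.linearCombination`, `Matrix`, `Matrix.vecMulVec`,
  `Submodule.projection`, `LinearMap.toMatrix'`, `Module.finBasis`, `Fintype.piFinset`.
-/

namespace Literature.QuantumTopology.MixedVerlinde

open Matrix



/-! ## 1. The Kauffman state model of the Temperley–Lieb category -/

/-- Basis index of `V^{⊗ n}` (`V = k²`): a bit-tuple of length `n`. [folklore] -/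
abbrev Idx (n : ℕ) := Fin n → Fin 2

/-- Basis of the ambient space `⊕ₙ V^{⊗ n}`: finite words in the alphabet `Fin 2`. [folklore] -/
abbrev TensorWord := List (Fin 2)

/-- The ambient space `TSpace k = ⊕ₙ V^{⊗ n}` of the state model, as finitely supported functions
on tensor words (Kauffman–Lins 1994, §2). [cite: KauffmanLins1994, §2] -/
abbrev TSpace (k : Type*) [Field k] := TensorWord →₀ k

/-- Operators of the state model: `k`-linear endomorphisms of `TSpace k`. [folklore] -/
abbrev TOp (k : Type*) [Field k] := TSpace k →ₗ[k] TSpace k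

section Coefficients

variable {k : Type*} [Field k]

/-- The cup (creation of two adjacent strands) of the Kauffman state model with variable
`A = ζ^{1/2}`: `cup = ∑ N a b • e_a ⊗ e_b` with `N = !![0, A; -A⁻¹, 0]`, i.e.
`cup = A·e₀⊗e₁ - A⁻¹·e₁⊗e₀` (Kauffman–Lins 1994, §2; the `ε`-tensor deformed by `A`).
[cite: KauffmanLins1994, §2] -/
def cupCoeff (A : k) : Matrix (Fin 2) (Fin 2) k := !![0, A; -A⁻¹, 0]

/-- The cap (annihilation of two adjacent strands): `cap (e_a ⊗ e_b) = N' a b` with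
`N' = !![0, -A; A⁻¹, 0] = N⁻¹`, so that both zig-zag identities hold and the closed loop is
`-A² - A⁻²` (Kauffman–Lins 1994, §2). [cite: KauffmanLins1994, §2] -/
def capCoeff (A : k) : Matrix (Fin 2) (Fin 2) k := !![0, -A; A⁻¹, 0]

/-- The loop value `δ = -A² - A⁻² = -(ζ + ζ⁻¹)` of the Temperley–Lieb category at `ζ = A²`
(Décoppet–Haïoun 2025, §2.1; it vanishes iff `ζ² = -1`). [cite: DecoppetHaioun2025, §2.1] -/
def loopValue (A : k) : k := -A ^ 2 - A⁻¹ ^ 2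

/-- Entry `(0,0)` of the cup matrix. [folklore] -/
@[simp] theorem cupCoeff_apply_00 (A : k) : cupCoeff A 0 0 = 0 := rfl

/-- Entry `(0,1)` of the cup matrix: the coefficient of `e₀ ⊗ e₁` is `A`. [folklore] -/
@[simp] theorem cupCoeff_apply_01 (A : k) : cupCoeff A 0 1 = A := rfl

/-- Entry `(1,0)` of the cup matrix: the coefficient of `e₁ ⊗ e₀` is `-A⁻¹`. [folklore] -/
@[simp] theorem cupCoeff_apply_10 (A : k) : cupCoeff A 1 0 = -A⁻¹ := rfl

/-- Entry `(1,1)` of the cup matrix. [folklore] -/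
@[simp] theorem cupCoeff_apply_11 (A : k) : cupCoeff A 1 1 = 0 := rfl

/-- Entry `(0,0)` of the cap matrix. [folklore] -/
@[simp] theorem capCoeff_apply_00 (A : k) : capCoeff A 0 0 = 0 := rfl

/-- Entry `(0,1)` of the cap matrix: `cap(e₀ ⊗ e₁) = -A`. [folklore] -/
@[simp] theorem capCoeff_apply_01 (A : k) : capCoeff A 0 1 = -A := rfl

/-- Entry `(1,0)` of the cap matrix: `cap(e₁ ⊗ e₀) = A⁻¹`. [folklore] -/
@[simp] theorem capCoeff_apply_10 (A : k) : capCoeff A 1 0 = A⁻¹ := rfl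

/-- Entry `(1,1)` of the cap matrix. [folklore] -/
@[simp] theorem capCoeff_apply_11 (A : k) : capCoeff A 1 1 = 0 := rfl

/-- The closed loop: `∑_{a,b} cap(a,b)·cup(a,b) = -A² - A⁻²` (Kauffman–Lins 1994, §2).
[cite: KauffmanLins1994, §2] -/
theorem capCoeff_cupCoeff_sum (A : k) :
    ∑ a : Fin 2, ∑ b : Fin 2, capCoeff A a b * cupCoeff A a b = loopValue A := by
  simp [Fin.sum_univ_two, loopValue]
  ring

/-- First zig-zag identity `N' N = 1` (the cap matrix is the inverse of the cup matrix), valid for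
`A ≠ 0` (Kauffman–Lins 1994, §2). [cite: KauffmanLins1994, §2] -/
theorem capCoeff_mul_cupCoeff (A : k) (hA : A ≠ 0) : capCoeff A * cupCoeff A = 1 := by
  ext i j
  fin_cases i <;> fin_cases j <;> simp [Matrix.mul_apply, Fin.sum_univ_two, hA]

/-- Second zig-zag identity `N N' = 1`, valid for `A ≠ 0` (Kauffman–Lins 1994, §2).
[cite: KauffmanLins1994, §2] -/
theorem cupCoeff_mul_capCoeff (A : k) (hA : A ≠ 0) : cupCoeff A * capCoeff A = 1 := by
  ext i j
  fin_cases i <;> fin_cases j <;> simp [Matrix.mul_apply, Fin.sum_univ_two, hA]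

/-- At a primitive fourth root of unity `ζ = A²` (i.e. `A⁴ = -1`) the loop value vanishes:
`-(ζ + ζ⁻¹) = 0` (Décoppet–Haïoun 2025, §2.2). [cite: DecoppetHaioun2025, §2.2] -/
theorem loopValue_eq_zero_of_pow_four (A : k) (hA : A ^ 4 = -1) : loopValue A = 0 := by
  have hmul : A ^ 2 * (-A ^ 2) = 1 := by
    rw [mul_neg, ← pow_add]
    norm_num [hA]
  have h2 : (A ^ 2)⁻¹ = -A ^ 2 := inv_eq_of_mul_eq_one_right hmul
  unfold loopValue
  rw [inv_pow, h2]
  ring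

/-! ### Two-strand matrices: `U = cup ∘ cap` and the crossings -/

/-- The Temperley–Lieb generator on two strands, `U = cup ∘ cap : V^{⊗2} → V^{⊗2}`, as the
rank-one `4 × 4` matrix `(cup)(cap)ᵀ` (Kauffman–Lins 1994, §2; Décoppet–Haïoun 2025, §2.1 "≍").
[cite: KauffmanLins1994, §2] -/
def uTwo (A : k) : Matrix (Idx 2) (Idx 2) k :=
  vecMulVec (fun u => cupCoeff A (u 0) (u 1)) (fun w => capCoeff A (w 0) (w 1))

/-- The crossing matrices of the Kauffman bracket: `rMatrix A true = A·𝟙 + A⁻¹·U` is the crossing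
whose strand running from bottom-left to top-right passes OVER (the crossing displayed in
Décoppet–Haïoun's rule `╱-over = ζ^{1/2}·|| + ζ^{-1/2}·≍`), and `rMatrix A false = A⁻¹·𝟙 + A·U` is
the other crossing (Kauffman 1987; Décoppet–Haïoun 2025, §2.1). [cite: DecoppetHaioun2025, §2.1] -/
def rMatrix (A : k) (over : Bool) : Matrix (Idx 2) (Idx 2) k :=
  if over then A • (1 : Matrix (Idx 2) (Idx 2) k) + A⁻¹ • uTwo A
  else A⁻¹ • (1 : Matrix (Idx 2) (Idx 2) k) + A • uTwo A

/-- A sum over the four basis indices of `V^{⊗2}` is the double sum over the two bits.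
[folklore] -/
theorem sum_idx_two {M : Type*} [AddCommMonoid M] (f : Idx 2 → M) :
    ∑ u, f u = ∑ a : Fin 2, ∑ b : Fin 2, f ![a, b] := by
  rw [← Fintype.sum_prod_type']
  refine Fintype.sum_equiv (finTwoArrowEquiv (Fin 2)) _ _ fun u => ?_
  simp only [finTwoArrowEquiv]
  congr 1
  ext i
  fin_cases i <;> rfl

/-- The pairing of the cap covector with the cup vector on two strands is the loop value:
`capᵀ · cup = δ`. [cite: KauffmanLins1994, §2] -/
theorem cap_dotProduct_cup (A : k) :
    (fun w : Idx 2 => capCoeff A (w 0) (w 1)) ⬝ᵥ (fun u : Idx 2 => cupCoeff A (u 0) (u 1))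
      = loopValue A := by
  simp only [dotProduct, sum_idx_two, Matrix.cons_val_zero, Matrix.cons_val_one]
  exact capCoeff_cupCoeff_sum A

/-- `U² = δ·U` on two strands (the loop relation; Kauffman–Lins 1994, §2).
[cite: KauffmanLins1994, §2] -/
theorem uTwo_mul_uTwo (A : k) : uTwo A * uTwo A = loopValue A • uTwo A := by
  unfold uTwo
  rw [vecMulVec_mul_vecMulVec, cap_dotProduct_cup, vecMulVec_smul]

/-- Product of two elements of the two-dimensional algebra spanned by `𝟙` and `U` on two strands:
`(a·𝟙 + b·U)(c·𝟙 + d·U) = ac·𝟙 + (ad + bc + bd·δ)·U`. [cite: KauffmanLins1994, §2] -/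
theorem smul_one_add_smul_uTwo_mul (A a b c d : k) :
    (a • (1 : Matrix (Idx 2) (Idx 2) k) + b • uTwo A) * (c • 1 + d • uTwo A)
      = (a * c) • (1 : Matrix (Idx 2) (Idx 2) k) + (a * d + b * c + b * d * loopValue A) • uTwo A := by
  simp only [add_mul, mul_add, smul_mul_assoc, mul_smul_comm, Matrix.one_mul, Matrix.mul_one,
    uTwo_mul_uTwo, smul_smul]
  module

/-- Reidemeister II in the state model: the two crossings are mutually inverse,
`(A·𝟙 + A⁻¹U)(A⁻¹·𝟙 + AU) = 𝟙 + (A² + A⁻² + δ)·U = 𝟙` for every `A ≠ 0` (Kauffman 1987).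
[cite: Kauffman1987] -/
theorem rMatrix_true_mul_false (A : k) (hA : A ≠ 0) :
    rMatrix A true * rMatrix A false = 1 := by
  simp only [rMatrix, if_true, Bool.false_eq_true, if_false]
  rw [smul_one_add_smul_uTwo_mul, mul_inv_cancel₀ hA, one_smul]
  have h : A * A + A⁻¹ * A⁻¹ + A⁻¹ * A * loopValue A = 0 := by
    unfold loopValue
    rw [inv_mul_cancel₀ hA]
    ring
  rw [h, zero_smul, add_zero]

/-- Reidemeister II, the other order. [cite: Kauffman1987] -/
theorem rMatrix_false_mul_true (A : k) (hA : A ≠ 0) :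
    rMatrix A false * rMatrix A true = 1 := by
  simp only [rMatrix, if_true, Bool.false_eq_true, if_false]
  rw [smul_one_add_smul_uTwo_mul, inv_mul_cancel₀ hA, one_smul]
  have h : A⁻¹ * A⁻¹ + A * A + A * A⁻¹ * loopValue A = 0 := by
    unfold loopValue
    rw [mul_inv_cancel₀ hA]
    ring
  rw [h, zero_smul, add_zero]

end Coefficients

/-! ### Local operators on the ambient space -/

section Operators

variable {k : Type*} [Field k]

/-- Replace the window `[i, i + n)` of a tensor word by the word of a tuple `u : Idx m`.
[folklore] -/
def spliceWord {m : ℕ} (i n : ℕ) (ℓ : TensorWord) (u : Idx m) : TensorWord :=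
  ℓ.take i ++ List.ofFn u ++ ℓ.drop (i + n)

/-- Read the window `[i, i + n)` of a tensor word as a tuple (junk letter `0` past the end).
[folklore] -/
def windowWord (i n : ℕ) (ℓ : TensorWord) : Idx n := fun j => ℓ.getD (i + j) 0

/-- **Local operator.** `localOp i n m B` acts on a basis word `ℓ` containing the window
`[i, i + n)` by `e_ℓ ↦ ∑_{u : Idx m} B u (window) • e_{splice u}` — the operator
`𝟙^{⊗ i} ⊗ B ⊗ 𝟙^{⊗ rest}` of the state model with `B : V^{⊗ n} → V^{⊗ m}` — and by `0` on basis
words of length `< i + n` (junk).  Kauffman–Lins (1994), §2 (abstract tensor contraction).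
[cite: KauffmanLins1994, §2] -/
noncomputable def localOp (i n m : ℕ) (B : Matrix (Idx m) (Idx n) k) : TOp k :=
  Finsupp.linearCombination k fun ℓ : TensorWord =>
    if i + n ≤ ℓ.length then
      ∑ u : Idx m, B u (windowWord i n ℓ) • Finsupp.single (spliceWord i n ℓ u) (1 : k)
    else 0

/-- `localOp` on a basis word long enough to contain the window. [folklore] -/
theorem localOp_single_of_le (i n m : ℕ) (B : Matrix (Idx m) (Idx n) k) (ℓ : TensorWord)
    (h : i + n ≤ ℓ.length) :
    localOp i n m B (Finsupp.single ℓ 1)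
      = ∑ u : Idx m, B u (windowWord i n ℓ) • Finsupp.single (spliceWord i n ℓ u) (1 : k) := by
  simp [localOp, h]

/-- `localOp` vanishes on basis words too short to contain the window (junk value). [folklore] -/
theorem localOp_single_of_lt (i n m : ℕ) (B : Matrix (Idx m) (Idx n) k) (ℓ : TensorWord)
    (h : ℓ.length < i + n) : localOp i n m B (Finsupp.single ℓ 1) = 0 := by
  simp [localOp, Nat.not_le.2 h]

/-- The cup inserted at position `i` (creating the strands `i, i + 1`):
`e_ℓ ↦ ∑_{a b} N a b • e_{ℓ[..i] a b ℓ[i..]}` (Kauffman–Lins 1994, §2).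
[cite: KauffmanLins1994, §2] -/
noncomputable def cupAt (A : k) (i : ℕ) : TOp k :=
  localOp i 0 2 (Matrix.of fun u _ => cupCoeff A (u 0) (u 1))

/-- The cap joining the strands `i, i + 1`: `e_ℓ ↦ N' ℓᵢ ℓᵢ₊₁ • e_{ℓ minus letters i, i+1}`
(Kauffman–Lins 1994, §2). [cite: KauffmanLins1994, §2] -/
noncomputable def capAt (A : k) (i : ℕ) : TOp k :=
  localOp i 2 0 (Matrix.of fun _ w => capCoeff A (w 0) (w 1))

/-- Insertion of a box `B : V^{⊗ n} → V^{⊗ n}` (a `2ⁿ × 2ⁿ` matrix) on the strands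
`i, …, i + n - 1` (Kauffman–Lins 1994, §2). [cite: KauffmanLins1994, §2] -/
noncomputable def boxAt (i n : ℕ) (B : Matrix (Idx n) (Idx n) k) : TOp k :=
  localOp i n n B

/-- The crossing of the strands `i, i + 1`; `over = true` means the strand running from
bottom-left to top-right passes over (Décoppet–Haïoun's displayed crossing, bracket value
`A·|| + A⁻¹·≍`). [cite: DecoppetHaioun2025, §2.1] -/
noncomputable def crossAt (A : k) (i : ℕ) (over : Bool) : TOp k :=
  boxAt i 2 (rMatrix A over)

/-- The Temperley–Lieb generator `Uᵢ = cupᵢ ∘ capᵢ` on the ambient space.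
[cite: KauffmanLins1994, §2] -/
noncomputable def uAt (A : k) (i : ℕ) : TOp k :=
  cupAt A i ∘ₗ capAt A i

end Operators



/-! ## 2. Eve projectors and Décoppet–Haïoun's boxes

### Cups and caps on `V^{⊗ n}` as linear maps of finite-dimensional spaces -/

section Eve

variable {k : Type*} [Field k]


/-- Insert the pair of letters `(a, b)` at positions `i, i + 1` of a tuple of length `n`.
[folklore] -/
def insertPair {n : ℕ} (i : Fin (n + 1)) (a b : Fin 2) (u : Idx n) : Idx (n + 2) :=
  Fin.insertNth i.castSucc a (Fin.insertNth i b u)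

/-- Delete the letters at positions `i, i + 1` of a tuple of length `n + 2`. [folklore] -/
def removePair {n : ℕ} (i : Fin (n + 1)) (w : Idx (n + 2)) : Idx n :=
  Fin.removeNth i (Fin.removeNth i.succ w)

/-- Insertion of a two-strand vector with coefficient matrix `c` at the pair of positions
`i, i + 1`: `(vIns c i x) w = c wᵢ wᵢ₊₁ · x (w minus positions i, i+1)`, i.e.
`x ↦ 𝟙^{⊗ i} ⊗ (∑ c a b • e_a ⊗ e_b) ⊗ 𝟙^{⊗ (n-i)}` applied to `x` (Kauffman–Lins 1994, §2).
[cite: KauffmanLins1994, §2] -/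
def vIns {n : ℕ} (c : Matrix (Fin 2) (Fin 2) k) (i : Fin (n + 1)) :
    (Idx n → k) →ₗ[k] (Idx (n + 2) → k) where
  toFun x w := c (w i.castSucc) (w i.succ) * x (removePair i w)
  map_add' x y := by
    ext w
    simp [mul_add]
  map_smul' r x := by
    ext w
    simp [mul_left_comm]

/-- The cup on the strands `i, i + 1` of `V^{⊗ (n+2)}`, as a linear map `V^{⊗ n} → V^{⊗ (n+2)}`
(Kauffman–Lins 1994, §2). [cite: KauffmanLins1994, §2] -/
def vCup {n : ℕ} (A : k) (i : Fin (n + 1)) : (Idx n → k) →ₗ[k] (Idx (n + 2) → k) :=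
  vIns (cupCoeff A) i

/-- The cap on the strands `i, i + 1` of `V^{⊗ (n+2)}`, as a linear map `V^{⊗ (n+2)} → V^{⊗ n}`:
`(vCap y) u = ∑_{a b} N' a b · y (u with (a, b) inserted at i)` (Kauffman–Lins 1994, §2).
[cite: KauffmanLins1994, §2] -/
def vCap {n : ℕ} (A : k) (i : Fin (n + 1)) : (Idx (n + 2) → k) →ₗ[k] (Idx n → k) where
  toFun y u := ∑ a : Fin 2, ∑ b : Fin 2, capCoeff A a b * y (insertPair i a b u)
  map_add' x y := by
    ext u
    simp [mul_add, Finset.sum_add_distrib]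
  map_smul' r x := by
    ext u
    simp only [Pi.smul_apply, smul_eq_mul, RingHom.id_apply, Fin.sum_univ_two]
    ring

/-- The **cap kernel** `K = ⋂ᵢ ker(capᵢ) ⊆ V^{⊗ (n+2)}`: vectors annihilated by capping any two
adjacent strands (the "highest-weight"/Jones–Wenzl summand; Goodman–Wenzl 1993, §2).
[cite: GoodmanWenzl1993, §2] -/
def capKer (n : ℕ) (A : k) : Submodule k (Idx (n + 2) → k) :=
  ⨅ i : Fin (n + 1), LinearMap.ker (vCap A i)

/-- The **cup range** `Q = Σᵢ im(cupᵢ) ⊆ V^{⊗ (n+2)}`: the span of all vectors containing a cup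
(the image of the ideal of non-identity Temperley–Lieb diagrams; Goodman–Wenzl 1993, §2).
[cite: GoodmanWenzl1993, §2] -/
def cupRange (n : ℕ) (A : k) : Submodule k (Idx (n + 2) → k) :=
  ⨆ i : Fin (n + 1), LinearMap.range (vCup A i)

/-! ### The Eve / Jones–Wenzl projector -/

open Classical in
/-- **Jones–Wenzl / Eve projector on `n + 2` strands.**  The projection of `V^{⊗ (n+2)}` onto the
cap kernel `capKer` along the cup range `cupRange` when `V^{⊗ (n+2)} = capKer ⊕ cupRange`, and the
junk value `id` otherwise.  When the Jones–Wenzl-type idempotent `f_{n+2} ∈ TL_{n+2}` (nonzero,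
killed by all cups on top and all caps below) exists it equals this projection (see the module
docstring); at `δ = 0` in characteristic `p` this is the case exactly for the Eves of
Sutton–Tubbenhauer–Wedrich–Zhu, in particular for `n + 2 = 2a - 1 ≤ 2p - 3` odd, where it is
Décoppet–Haïoun's `E_{2a-1} = E_{v-1}` for the Eve `v = 2a = [a, 0]_{p,2}` (DH 2025, §2.1
eq. (7)–(8); STWZ 2023, §3). [cite: SuttonEtAl2023, §3] -/
noncomputable def jwProj (A : k) (n : ℕ) : (Idx (n + 2) → k) →ₗ[k] (Idx (n + 2) → k) :=
  if h : IsCompl (capKer n A) (cupRange n A) then (capKer n A).projection (cupRange n A) h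
  else LinearMap.id

/-- When cap kernel and cup range are complementary, the Eve projector is idempotent.
[cite: SuttonEtAl2023, §3] -/
theorem isIdempotentElem_jwProj (A : k) (n : ℕ) (h : IsCompl (capKer n A) (cupRange n A)) :
    IsIdempotentElem (jwProj A n) := by
  rw [jwProj, dif_pos h]
  exact Submodule.isIdempotentElem_projection h

/-- … its range is the cap kernel (the summand `T(n+1)`), … [cite: SuttonEtAl2023, §3] -/
theorem range_jwProj (A : k) (n : ℕ) (h : IsCompl (capKer n A) (cupRange n A)) :
    LinearMap.range (jwProj A n) = capKer n A := by
  rw [jwProj, dif_pos h]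
  exact Submodule.range_projection h

/-- … and its kernel is the cup range. [cite: SuttonEtAl2023, §3] -/
theorem ker_jwProj (A : k) (n : ℕ) (h : IsCompl (capKer n A) (cupRange n A)) :
    LinearMap.ker (jwProj A n) = cupRange n A := by
  rw [jwProj, dif_pos h]
  exact Submodule.ker_projection h

/-- The Eve projector is killed by every cap: `capᵢ ∘ f = 0` (DH 2025, eq. (8), first identity).
[cite: DecoppetHaioun2025, §2.1] -/
theorem vCap_comp_jwProj (A : k) (n : ℕ) (h : IsCompl (capKer n A) (cupRange n A))
    (i : Fin (n + 1)) : vCap A i ∘ₗ jwProj A n = 0 := by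
  apply LinearMap.ext
  intro x
  have hx : jwProj A n x ∈ capKer n A := by
    rw [← range_jwProj A n h]
    exact LinearMap.mem_range_self _ x
  simp only [capKer, Submodule.mem_iInf, LinearMap.mem_ker] at hx
  simpa using hx i

/-- The Eve projector kills every cup: `f ∘ cupᵢ = 0` (DH 2025, eq. (8); STWZ 2023, Thm. 3.19).
[cite: DecoppetHaioun2025, §2.1] -/
theorem jwProj_comp_vCup (A : k) (n : ℕ) (h : IsCompl (capKer n A) (cupRange n A))
    (i : Fin (n + 1)) : jwProj A n ∘ₗ vCup A i = 0 := by
  apply LinearMap.ext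
  intro x
  have hx : vCup A i x ∈ cupRange n A := by
    apply Submodule.mem_iSup_of_mem i
    exact LinearMap.mem_range_self _ x
  rw [← ker_jwProj A n h] at hx
  simpa using hx

/-- The Eve projector as a `2^{n} × 2^{n}` matrix on `n` strands; `𝟙` on `0` and `1` strands
(`E₀`, `E₁ = id_{T(1)}`). [cite: SuttonEtAl2023, §3] -/
noncomputable def jwMatrix (A : k) : (n : ℕ) → Matrix (Idx n) (Idx n) k
  | 0 => 1
  | 1 => 1
  | n + 2 => LinearMap.toMatrix' (jwProj A n)

/-! ### Décoppet–Haïoun's idempotents `E_{v-1}` at height two, the box `Z⁰_v`, chromatic boxes -/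

/-- Add an idle strand on the right: `B ↦ B ⊗ 𝟙_V` (`(B ⊗ 𝟙) u w = B (init u) (init w)` if the
last letters agree, else `0`). [folklore] -/
def padRight {n : ℕ} (B : Matrix (Idx n) (Idx n) k) : Matrix (Idx (n + 1)) (Idx (n + 1)) k :=
  Matrix.of fun u w => if u (Fin.last n) = w (Fin.last n) then B (Fin.init u) (Fin.init w) else 0

/-- **Décoppet–Haïoun's idempotent `E_n` on `n` strands** (`n = v - 1`, `2 ≤ v ≤ 2p - 1`) for ζ a
primitive fourth root of unity: `E_n` is the Eve projector if `n` is odd (`v = [a₁, 0]_{p,2}`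
even, `T(v-1)` simple projective) and `E_{n-1} ⊗ 𝟙` if `n ≥ 2` is even (`v = [a₁, 1]_{p,2}`;
DH 2025, Prop. 2.3 (1) and Example 2.1: `E₂ = 𝟙`, `E₄ = E₃ ⊗ 𝟙`); `E₀ = 𝟙`.
[cite: DecoppetHaioun2025, Prop. 2.3] -/
noncomputable def dhE (A : k) : (n : ℕ) → Matrix (Idx n) (Idx n) k
  | 0 => 1
  | n + 1 => if Even n then jwMatrix A (n + 1) else padRight (jwMatrix A n)

/-- The Temperley–Lieb generator `U = cup ∘ cap` on the LAST two of `n + 2` strands,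
`𝟙^{⊗ n} ⊗ U`. [cite: KauffmanLins1994, §2] -/
def uLast (A : k) (n : ℕ) : Matrix (Idx (n + 2)) (Idx (n + 2)) k :=
  Matrix.of fun u w =>
    if Fin.init (Fin.init u) = Fin.init (Fin.init w) then
      cupCoeff A (u (Fin.last n).castSucc) (u (Fin.last (n + 1)))
        * capCoeff A (w (Fin.last n).castSucc) (w (Fin.last (n + 1)))
    else 0

/-- **Décoppet–Haïoun's box `Z⁰_v`** on `v = n + 3` strands (`v = [a₁, 1]_{p,2}` odd):
`Z⁰_v = (E_{v-1} ⊗ 𝟙) ∘ ((E_{v-2} ⊗ 𝟙 ⊗ 𝟙) ∘ U_{last}) ∘ (E_{v-1} ⊗ 𝟙)`, the map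
`A⁰_v → Ã⁰_v` of DH's basis of `End(T(v-1) ⊗ T(1))` (DH 2025, Notation 2.4, eq. (10)–(11):
reading the diagram bottom-up — `E_{v-1} ⊗ 𝟙`, cap the last two strands, `E_{v-2}`, cup, then
`E_{v-1} ⊗ 𝟙`). [cite: DecoppetHaioun2025, Notation 2.4] -/
noncomputable def zBox (A : k) (n : ℕ) : Matrix (Idx (n + 3)) (Idx (n + 3)) k :=
  padRight (dhE A (n + 2)) * (padRight (padRight (dhE A (n + 1))) * uLast A (n + 1))
    * padRight (dhE A (n + 2))

/-- The scalar `(-1)^{a₁ - 1} a₁ ∈ k` attached to `v = [a₁, a₀]_{p,2} = 2a₁ + a₀`: the modified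
trace `t(E_{2a₁-1})` of the simple projective `T(2a₁-1)` normalised by `t(E₁) = 1`
(DH 2025, Prop. 3.1). [cite: DecoppetHaioun2025, Prop. 3.1] -/
def eveCoeff (k : Type*) [Field k] (v : ℕ) : k := (-1) ^ (v / 2 - 1) * ((v / 2 : ℕ) : k)

/-- **Décoppet–Haïoun's chromatic boxes.**  `chromBox A v ∈ End(V^{⊗ v})` is
`c_{v-1} ∈ End(T(v-1) ⊗ T(1))` of DH 2025, Prop. 3.4 — `(-1)^{a₁-1} a₁ · (E_{v-1} ⊗ E₁)` for
`v = 2a₁` and `(-1)^{a₁-1} a₁ · Z⁰_v` for `v = 2a₁ + 1` — placed on `v` strands with the `v - 1`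
strands of `T(v-1)` on the LEFT and the `T(1)` strand on the right; `0` for `v ≤ 1` (no such
projective).  Their sum over `v = 2, …, 2p - 1` is a chromatic morphism based at `T(1)` for the
projective generator `G = ⊕_v T(v-1)` of `Ver^{ζ^{1/2}}_{p^{(2)}}` (DH 2025, Prop. 3.4; CGHP 2023,
Def. of chromatic morphism = DH Def. 1.7). [cite: DecoppetHaioun2025, Prop. 3.4] -/
noncomputable def chromBox (A : k) : (v : ℕ) → Matrix (Idx v) (Idx v) k
  | 0 => 0
  | 1 => 0
  | 2 => eveCoeff k 2 • padRight (dhE A 1)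
  | n + 3 => if Even (n + 3) then eveCoeff k (n + 3) • padRight (dhE A (n + 2))
      else eveCoeff k (n + 3) • zBox A n

/-- For `v = 2` the chromatic box is the identity of `T(1) ⊗ T(1)` (`a₁ = 1`, `E₁ = 𝟙`):
`c₁ = E₁ ⊗ E₁` (DH 2025, Prop. 3.4 with `t(E₁) = 1`). [cite: DecoppetHaioun2025, Prop. 3.4] -/
theorem chromBox_two (A : k) : chromBox A 2 = padRight 1 := by
  simp [chromBox, eveCoeff, dhE, jwMatrix]

end Eve

/-! ## 3. The modified trace and the cutting operators -/

section Cutting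

variable {k : Type*} [Field k]

/-- The weight of a closing strand in state `b`: `μ(b) = cup(b, ¬b)·cap(b, ¬b)`, i.e.
`μ(0) = A·(-A) = -A²`, `μ(1) = (-A⁻¹)·A⁻¹ = -A⁻²` (the entries of the pivotal matrix of the state
model; their sum is the loop value). [cite: KauffmanLins1994, §2] -/
def muWeight (A : k) (b : Fin 2) : k := if b = 0 then -A ^ 2 else -A⁻¹ ^ 2

/-- `μ(0) + μ(1) = δ`: closing a single idle strand gives the loop value.
[cite: KauffmanLins1994, §2] -/
theorem muWeight_zero_add_one (A : k) : muWeight A 0 + muWeight A 1 = loopValue A := by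
  simp [muWeight, loopValue, sub_eq_add_neg]

/-- **The modified trace functional on `n + 1` strands.**  For `F ∈ End(V^{⊗(n+1)})` put
`mTrace A n F = ∑_{s : Idx n} F (0·s) (0·s) · ∏ⱼ μ(sⱼ)`.  Closing the last `n` strands of `F` on
the right with nested caps/cups forces equal cup- and cap-states on each closed strand, with weight
`μ`, so the right partial trace is `pTr(F)_{a b} = ∑_s F_{(a s)(b s)} ∏ μ(sⱼ)`; when `F` is the
matrix of a Temperley–Lieb morphism, `pTr(F) ∈ End(T(1)) = k·𝟙` is a scalar matrix `λ·𝟙` and the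
modified trace is `t(F) = t(pTr(F)) = λ·t(E₁) = λ` (Décoppet–Haïoun 2025, §3.1 with `t(E₁) = 1`,
and eq. (1)); we read off `λ` as the `(0,0)` entry.  On a general matrix this is just that entry
(junk outside the Temperley–Lieb image). [cite: DecoppetHaioun2025, §3.1] -/
def mTrace (A : k) (n : ℕ) (F : Matrix (Idx (n + 1)) (Idx (n + 1)) k) : k :=
  ∑ s : Idx n, F (Fin.cons 0 s) (Fin.cons 0 s) * ∏ j, muWeight A (s j)

/-- `t(E₁) = 1`: the normalisation of Décoppet–Haïoun (2025), §3.1.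
[cite: DecoppetHaioun2025, §3.1] -/
theorem mTrace_zero_one (A : k) : mTrace A 0 1 = 1 := by
  simp [mTrace]

/-- The **cup span** `W_N ⊆ V^{⊗N}`: the image of `TL(0, N) = Hom(𝟙, T(1)^{⊗N})` in the state
model, i.e. the span of the vectors of all crossingless cup diagrams, generated recursively by
inserting cups (`W₀ = k`, `W₁ = 0`, `W_{N+2} = Σᵢ cupᵢ(W_N)`). [cite: KauffmanLins1994, §2] -/
noncomputable def cupSpan (A : k) : (N : ℕ) → Submodule k (Idx N → k)
  | 0 => ⊤
  | 1 => ⊥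
  | N + 2 => ⨆ i : Fin (N + 1), (cupSpan A N).map (vCup A i)

/-- The **cap span** `W'_N`: the image of `TL(N, 0) = Hom(T(1)^{⊗N}, 𝟙)`, as covectors
`φ : Idx N → k` (`φ(e_w)` listed), generated recursively by `φ ↦ φ ∘ capᵢ`, which in coordinates is
the insertion map `vIns (capCoeff A) i`. [cite: KauffmanLins1994, §2] -/
noncomputable def capSpan (A : k) : (N : ℕ) → Submodule k (Idx N → k)
  | 0 => ⊤
  | 1 => ⊥
  | N + 2 => ⨆ i : Fin (N + 1), (capSpan A N).map (vIns (capCoeff A) i)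

/-- The **modified-trace pairing** `⟨x, φ⟩ = t_{T(1)^{⊗N}}(x ∘ φ)` of a vector
`x ∈ Hom(𝟙, T(1)^{⊗N})` with a covector `φ ∈ Hom(T(1)^{⊗N}, 𝟙)` (the rank-one endomorphism `x φᵀ`),
the pairing whose dual bases define the cutting morphism (Décoppet–Haïoun 2025, Def. 1.5; it is
non-degenerate on the quotient by the ideal `J_{p^{(2)}}`, GKP/CGHP); `0` for `N = 0` (no projective
strand). [cite: DecoppetHaioun2025, Def. 1.5] -/
def mPair (A : k) : (N : ℕ) → (Idx N → k) → (Idx N → k) → k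
  | 0 => fun _ _ => 0
  | n + 1 => fun x φ => mTrace A n (vecMulVec x φ)

/-- Every matrix over a field has a generalized (`{1}`-)inverse: `M G M = M` (rank factorisation
through the range). [folklore] -/
theorem exists_generalizedInverse {m n : Type*} [Fintype m] [Fintype n]
    [DecidableEq m] [DecidableEq n] (M : Matrix m n k) : ∃ G : Matrix n m k, M * G * M = M := by
  let f : (n → k) →ₗ[k] (m → k) := Matrix.toLin' M
  obtain ⟨s, hs⟩ := f.rangeRestrict.exists_rightInverse_of_surjective f.range_rangeRestrict
  obtain ⟨π, hπ⟩ :=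
    (LinearMap.range f).subtype.exists_leftInverse_of_injective (Submodule.ker_subtype _)
  have h1 : ∀ y : LinearMap.range f, f (s y) = y := fun y => by
    have := LinearMap.congr_fun hs y
    simpa using congrArg Subtype.val this
  have h2 : ∀ x, π (f x) = f.rangeRestrict x := fun x => by
    simpa using LinearMap.congr_fun hπ (f.rangeRestrict x)
  have key : f ∘ₗ ((s ∘ₗ π) ∘ₗ f) = f := by
    apply LinearMap.ext
    intro x
    simp only [LinearMap.coe_comp, Function.comp_apply]
    rw [h2, h1]
    rfl
  refine ⟨LinearMap.toMatrix' (s ∘ₗ π), ?_⟩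
  have hM : LinearMap.toMatrix' f = M := LinearMap.toMatrix'_toLin' M
  calc M * LinearMap.toMatrix' (s ∘ₗ π) * M
      = LinearMap.toMatrix' f * LinearMap.toMatrix' (s ∘ₗ π) * LinearMap.toMatrix' f := by rw [hM]
    _ = LinearMap.toMatrix' (f ∘ₗ ((s ∘ₗ π) ∘ₗ f)) := by
        rw [LinearMap.toMatrix'_comp, LinearMap.toMatrix'_comp, Matrix.mul_assoc]
    _ = M := by rw [key, hM]

/-- **The cutting operator on `N` strands** — a lift to `End(V^{⊗N})` of the cutting morphism
`Λ_{T(1)^{⊗N}} = ∑ᵢ xᵢ ∘ xⁱ` of Décoppet–Haïoun (2025), Def. 1.5 (CGHP 2023), where `(xᵢ)`,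
`(xⁱ)` are dual bases of `Hom(𝟙, T(1)^{⊗N})` and `Hom(T(1)^{⊗N}, 𝟙)` for the modified-trace
pairing.  Concretely: bases `bW`, `bX` of the cup span and the cap span, Gram matrix
`M i j = mPair (bW i) (bX j)`, a generalized inverse `G` of `M` (`M G M = M`), and
`Λ_N = ∑_{i j} G j i • (bW i)(bX j)ᵀ`.  The radical of the pairing on the spans is their
intersection with the ideal `J_{p^{(2)}}` (the pairing is non-degenerate on
`Hom_{Ver}(𝟙, P) × Hom_{Ver}(P, 𝟙)`, GKP 2022 Cor. 5.6 as cited in DH §1.2, and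
`Tilt/J_{p^{(2)}} → Ver` is fully faithful), so any two such lifts — for any choice of bases and
of `G` — differ by an element of `J_{p^{(2)}}`, on which the invariant does not depend (CGHP).
`Λ₀ := 0` (a plate must be pierced; see the module docstring), and `Λ_N = 0` for odd `N`
automatically (`W_N = 0`).  By additivity/naturality of the Casimir element, `e ∘ Λ_N ∘ e` is the
cutting morphism of the summand cut out by any idempotent `e` (the cables' `E`'s), so this single
operator serves every plate pierced by `N` cabled strands (DH eq. (3), Lemma 3.2).
[cite: DecoppetHaioun2025, Def. 1.5] -/
noncomputable def cuttingMatrix (A : k) : (N : ℕ) → Matrix (Idx N) (Idx N) k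
  | 0 => 0
  | N + 1 =>
    let bW := Module.finBasis k (cupSpan A (N + 1))
    let bX := Module.finBasis k (capSpan A (N + 1))
    let M : Matrix (Fin (Module.finrank k (cupSpan A (N + 1))))
        (Fin (Module.finrank k (capSpan A (N + 1)))) k :=
      Matrix.of fun i j => mPair A (N + 1) (bW i) (bX j)
    let G := Classical.choose (exists_generalizedInverse M)
    ∑ i, ∑ j, G j i • vecMulVec ((bW i : cupSpan A (N + 1)) : Idx (N + 1) → k)
      ((bX j : capSpan A (N + 1)) : Idx (N + 1) → k)

end Cutting

/-! ## 4. Plat words and the invariant -/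

section Invariant

variable {k : Type*} [Field k]

/-- Strand labels of a plat word: `gamma` = a strand of the blue skein `Γ₀` (colour `T_ζ(1)`),
`handle j` = a strand of the attaching circle of the 2-handle number `j` (to be coloured by the
projective generator `G` after red-to-blue). [cite: DecoppetHaioun2025, §1.3] -/
inductive Strand
  /-- a strand of `Γ₀`, colour `T_ζ(1)` -/
  | gamma
  /-- a strand of the attaching curve of 2-handle `j` -/
  | handle (j : ℕ)
  deriving DecidableEq

/-- The slices of a plat word (read bottom to top); see the module docstring for the precise
pictures.  Positions are 0-based from the left and refer to the UNCABLED strands.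
[cite: DecoppetHaioun2025, §1.3] -/
inductive Slice
  /-- local minimum creating strands `i, i+1` with label `c` -/
  | cup (i : ℕ) (c : Strand)
  /-- local maximum joining strands `i, i+1` (equal labels) -/
  | cap (i : ℕ)
  /-- crossing of strands `i, i+1`; `over = true` iff the bottom-left-to-top-right strand is above -/
  | cross (i : ℕ) (over : Bool)
  /-- spanning disc of a dotted circle pierced by the `n ≥ 1` strands `i, …, i+n-1` -/
  | plate (i n : ℕ)
  /-- chromatic box: `handle j` at `i`, `gamma` at `i+1` -/
  | chrom (i : ℕ)
  deriving DecidableEq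

/-- A **plat word**: a dotted-circle Kirby diagram together with the cut-open skein `Γ₀`, in Morse
position, as a list of slices from bottom to top. [cite: DecoppetHaioun2025, §1.3] -/
abbrev PlatWord := List Slice

/-- Cable width of a labelled strand for a colouring `v : ℕ → ℕ` of the handles:
`gamma ↦ 1` (`T(1)`), `handle j ↦ v j - 1` (`T(v_j - 1)` is a cable of `v_j - 1` strands).
[cite: DecoppetHaioun2025, §2.1] -/
def Strand.width (v : ℕ → ℕ) : Strand → ℕ
  | Strand.gamma => 1
  | Strand.handle j => v j - 1

/-- Position of the first cabled strand of the uncabled strand `i`: total width to its left.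
[folklore] -/
def offsetOf (v : ℕ → ℕ) (L : List Strand) (i : ℕ) : ℕ := ((L.take i).map (Strand.width v)).sum

/-- Total cabled width of the uncabled strands `i, …, i + n - 1`. [folklore] -/
def widthOf (v : ℕ → ℕ) (L : List Strand) (i n : ℕ) : ℕ :=
  (((L.drop i).take n).map (Strand.width v)).sum

/-- Cabled cup of width `w` at cabled position `I`: `w` nested cups, outermost first
(`cup_I`, then `cup_{I+1}` inside it, …). [cite: KauffmanLins1994, §2] -/
noncomputable def cableCup (A : k) (I : ℕ) : ℕ → TOp k
  | 0 => LinearMap.id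
  | w + 1 => cupAt A (I + w) ∘ₗ cableCup A I w

/-- Cabled cap of width `w` at cabled position `I`: innermost cap first
(`cap_{I+w-1}`, …, `cap_I` last). [cite: KauffmanLins1994, §2] -/
noncomputable def cableCap (A : k) (I : ℕ) : ℕ → TOp k
  | 0 => LinearMap.id
  | w + 1 => cableCap A I w ∘ₗ capAt A (I + w)

/-- One strand starting at cabled position `J` crosses the `w` strands to its right, all crossings
of type `over` (`cross_J`, then `cross_{J+1}`, …). [cite: KauffmanLins1994, §2] -/
noncomputable def strandAcross (A : k) (over : Bool) (J : ℕ) : ℕ → TOp k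
  | 0 => LinearMap.id
  | w + 1 => crossAt A (J + w) over ∘ₗ strandAcross A over J w

/-- Cabled crossing at cabled position `I` of a left cable of width `w₁` with a right cable of
width `w₂` (blackboard-parallel cables): the rightmost strand of the left cable crosses the right
cable first, then the next one, …; all `w₁ w₂` elementary crossings have the type `over` of the
uncabled crossing (naturality of the braiding). [cite: KauffmanLins1994, §2] -/
noncomputable def cableCross (A : k) (over : Bool) (I w₂ : ℕ) : ℕ → TOp k
  | 0 => LinearMap.id
  | w₁ + 1 => cableCross A over I w₂ w₁ ∘ₗ strandAcross A over (I + w₁) w₂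

/-- **One slice of the evaluation** (state = current labels, `none` once the word is ill-formed,
and the current vector).  `cup`/`cap`/`cross` act by their cabled versions, `plate i n` by the
cutting operator `Λ_N` on the `N` cabled strands through the plate (`n ≥ 1` required),
`chrom i` by DH's box `c_{v_j-1}` on the cable of `handle j` (at `i`) and the `gamma` strand at
`i + 1`.  Décoppet–Haïoun (2025), §1.3 (Figure 1) with §3. [cite: DecoppetHaioun2025, §1.3] -/
noncomputable def evalSlice (A : k) (v : ℕ → ℕ) :
    Option (List Strand) × TSpace k → Slice → Option (List Strand) × TSpace k
  | (none, _), _ => (none, 0)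
  | (some L, x), Slice.cup i c =>
      if i ≤ L.length then
        (some (L.take i ++ [c, c] ++ L.drop i), cableCup A (offsetOf v L i) (c.width v) x)
      else (none, 0)
  | (some L, x), Slice.cap i =>
      match L[i]?, L[i + 1]? with
      | some c, some c' =>
          if c = c' then
            (some (L.take i ++ L.drop (i + 2)), cableCap A (offsetOf v L i) (c.width v) x)
          else (none, 0)
      | _, _ => (none, 0)
  | (some L, x), Slice.cross i over =>
      match L[i]?, L[i + 1]? with
      | some c, some c' =>
          (some (L.take i ++ [c', c] ++ L.drop (i + 2)),
            cableCross A over (offsetOf v L i) (c'.width v) (c.width v) x)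
      | _, _ => (none, 0)
  | (some L, x), Slice.plate i n =>
      if i + n ≤ L.length ∧ 0 < n then
        (some L, boxAt (offsetOf v L i) (widthOf v L i n) (cuttingMatrix A (widthOf v L i n)) x)
      else (none, 0)
  | (some L, x), Slice.chrom i =>
      match L[i]?, L[i + 1]? with
      | some (Strand.handle j), some Strand.gamma =>
          (some L, boxAt (offsetOf v L i) (v j) (chromBox A (v j)) x)
      | _, _ => (none, 0)

/-- Evaluate a whole plat word on the open `Γ₀` strand in state `e₀`: start from labels `[gamma]`
and the vacuum word `[0]`. [cite: DecoppetHaioun2025, §1.3] -/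
noncomputable def evalWord (A : k) (v : ℕ → ℕ) (w : PlatWord) : Option (List Strand) × TSpace k :=
  w.foldl (evalSlice A v) (some [Strand.gamma], Finsupp.single [0] 1)

/-- The contribution `λ_v` of one colouring: the coefficient of the vacuum word `[0]` in the
evaluated word (the scalar by which the cut-open skein acts on `T_ζ(1)`, = its modified trace
since `t(E₁) = 1`), or `0` if the word is ill-formed / does not close up to the single `Γ₀`
strand. [cite: DecoppetHaioun2025, §3.1] -/
noncomputable def colourValue (A : k) (v : ℕ → ℕ) (w : PlatWord) : k :=
  match evalWord A v w with
  | (some [Strand.gamma], x) => x [0]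
  | _ => 0

/-- Extend a colouring of the handles `0, …, m - 1` to all labels (junk `0` beyond). [folklore] -/
def extendColouring (m : ℕ) (f : Fin m → ℕ) : ℕ → ℕ := fun j => if h : j < m then f ⟨j, h⟩ else 0

/-- **The Décoppet–Haïoun invariant `Ṡ^{ζ^{1/2}}_{p^{(2)}}(W) ∈ k` of the 4-dimensional 2-handlebody
`W` presented by the plat word `w` with 2-handles labelled `0, …, m - 1`**, for a prime `p > 3`
and `A = ζ^{1/2}` a primitive eighth root of unity in `k` of characteristic `p`:
`Ṡ(W) = ∑_{v : Fin m → [2, 2p-1]} λ_v`, the sum over the indecomposable summands `T_ζ(v_j - 1)` of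
the projective generator `G = ⊕_{v=2}^{2p-1} T_ζ(v-1)` colouring each 2-handle
(Décoppet–Haïoun 2025, Def. 1.11 with §1.3 and §3; see the module docstring for the formula and
its justification).  For other parameters the value is whatever the formula gives.
[cite: DecoppetHaioun2025, Def. 1.11] -/
noncomputable def mixedVerlindeHandlebodyInvariant (p : ℕ) (A : k) (m : ℕ) (w : PlatWord) : k :=
  ∑ f ∈ Fintype.piFinset (fun _ : Fin m => Finset.Icc 2 (2 * p - 1)),
    colourValue A (extendColouring m f) w

/-- **The route's `σ_p`.**  For an `n`-component R-link `L ⊂ S³` with a complete sphere system,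
the value `S_{Ver_{p^{(2)}}}(Σ_L ∖ 0h : S³ → ∅)(Γ₀)` requested by route `VerlindeRLinks` is the
Décoppet–Haïoun invariant of the same cobordism read as `-W` for the upside-down 2-handlebody
`W` (n 1-handles dual to the 3-handles, n 2-handles dual to the 2-handles, `∂W = S³`;
Décoppet–Haïoun 2025, §1.3 and footnote 2), i.e. this function applied to a plat word of the dual
dotted-circle diagram. [cite: DecoppetHaioun2025, §1.3] -/
noncomputable abbrev mixedVerlindeRLinkInvariant (p : ℕ) (A : k) (n : ℕ) (w : PlatWord) : k :=
  mixedVerlindeHandlebodyInvariant p A n w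

/-! ### Test words (the diagrams of Décoppet–Haïoun §4) -/

/-- `|f|` curls of sign `sign f` on the strand at position `1` (a `handle 0` strand going up):
each curl is `cup 2`, `cross 1 (f > 0)`, `cap 2`; one positive curl is DH's twist `θ`.
[cite: DecoppetHaioun2025, §2.5] -/
def curls (f : ℤ) : PlatWord :=
  (List.replicate f.natAbs [Slice.cup 2 (Strand.handle 0), Slice.cross 1 (decide (0 < f)),
    Slice.cap 2]).flatten

/-- The 2-handlebody `D⁴ ∪ (one 2-handle along an unknot with framing f)` — `CP² ∖ ball`,
`CP²bar ∖ ball` for `f = ±1` in DH's convention `Δ_± = t((θ^{±1} ⊗ E₁) ∘ c)`, `S² × D²` for `f = 0`: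
the handle circle to the left of the `Γ₀` strand, `|f|` curls, the chromatic box, close up
(Décoppet–Haïoun 2025, §4.1 and Remark 4.2). [cite: DecoppetHaioun2025, §4.1] -/
def unknotWord (f : ℤ) : PlatWord :=
  [Slice.cup 0 (Strand.handle 0)] ++ curls f ++ [Slice.chrom 1, Slice.cap 0]

/-- The 2-handlebody on the 0-framed Hopf link (`S² × S²` minus a ball; Décoppet–Haïoun 2025,
§4.2): handle `1` nested inside handle `0`, a clasp of two crossings of the same type, the `Γ₀`
strand fingered in (over both times) to carry the two chromatic boxes.
[cite: DecoppetHaioun2025, §4.2] -/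
def hopfWord : PlatWord :=
  [Slice.cup 0 (Strand.handle 0), Slice.cup 1 (Strand.handle 1), Slice.cross 2 true,
    Slice.cross 2 true, Slice.cross 3 false, Slice.chrom 2, Slice.cross 3 true, Slice.chrom 3,
    Slice.cap 1, Slice.cap 0]

/-- A dotted circle with a 0-framed meridian 2-handle (a cancelling 1/2 pair, 2-equivalent to
`D⁴`): the handle circle passes once through the plate. [cite: DecoppetHaioun2025, §1.1] -/
def cancellingPairWord : PlatWord :=
  [Slice.cup 0 (Strand.handle 0), Slice.plate 0 1, Slice.chrom 1, Slice.cap 0]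

/-! ### API and named facts -/

/-- With no handles the colour sum has exactly one term (the empty colouring). [folklore] -/
theorem piFinset_fin_zero (S : Finset ℕ) :
    Fintype.piFinset (fun _ : Fin 0 => S) = {Fin.elim0} := by
  ext f
  simp only [Fintype.mem_piFinset, Finset.mem_singleton]
  constructor
  · intro _
    funext i
    exact i.elim0
  · intro _ i
    exact i.elim0

/-- **`Ṡ(D⁴) = 1`**: the empty word (the 2-handlebody with a single 4-handle, i.e. `-D⁴ : S³ → ∅`)
evaluates to `t(Γ₀) = t(E₁) = 1` (Décoppet–Haïoun 2025, §4, "by convention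
`Ṡ(D⁴) = 1`", and Example 3.3). [cite: DecoppetHaioun2025, §4] -/
theorem mixedVerlindeHandlebodyInvariant_nil (p : ℕ) (A : k) :
    mixedVerlindeHandlebodyInvariant p A 0 [] = 1 := by
  simp [mixedVerlindeHandlebodyInvariant, colourValue, evalWord]

/-- **Décoppet–Haïoun's Theorem B** (arXiv:2512.14849, Thm. B = Thm. 4.1 + Thm. 4.3), transcribed
to plat words: for every prime `p > 3`, every field `k` of characteristic `p` and every `A ∈ k` with
`A⁴ = -1` (so `ζ = A²` is a primitive fourth root of unity and `A = ζ^{1/2}`), the invariant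
vanishes on `CP²`, `CP²bar` (the `±1`-framed unknot) and on `S² × S²` (the 0-framed Hopf link):
`Δ₊ = Δ₋ = (p-1)p(2p-1)/3 · ζ^{∓1} = 0` and `Ṡ(Hopf) = ∑_v t((Δ⁰_{v-1} ⊗ 𝟙) c_{v-1}) = 0`.  The
identification of the three words with DH's diagrams is this file's encoding (module docstring);
a named fact, not proved here. [cite: DecoppetHaioun2025, Thm. B] -/
def decoppetHaioun_theoremB : Prop :=
  ∀ (p : ℕ), p.Prime → 3 < p → ∀ (k : Type) [Field k] [CharP k p] (A : k), A ^ 4 = -1 →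
    mixedVerlindeHandlebodyInvariant p A 1 (unknotWord 1) = 0 ∧
    mixedVerlindeHandlebodyInvariant p A 1 (unknotWord (-1)) = 0 ∧
    mixedVerlindeHandlebodyInvariant p A 2 hopfWord = 0

end Invariant

end Literature.QuantumTopology.MixedVerlinde
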